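import Summits.HubbardSuperconductivity.HubbardSuperconductivity.Theses.DeformationLadder
import Literature.MathematicalPhysics.QuantumLattice.LiebFluxPhaseGauge

/-!
# Sketch — crux-ideate `stmt-HubbardSuperconductivity-1890` (`LadderThesis`), ideator k = 2, round 1

Card `pinned-up-gauge-frame`: the zero-mode d-wave pair penalty `Π₀ = L⁻⁴ pFᴴ pF` is ONE POINT of the
orbit of the sector-preserving flat spin-↑ gauge group `{D_k : k ∈ (ℤ/L)²}`,
`D_k = exp(-i Σ_x (2π/L)(k·x) n_{x↑})`; `D_k Π₀ D_kᴴ = Π_k` EXACTLY (pair momentum `k`, phase on the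
↑ site), `D_k H D_kᴴ ≅ H` (flat connection).  The statements below are the card's `First lemma`
(`Covariance`), its companions (`PairFieldAtZero`, `OrbitSumRule`, `TwistIsospectral`), the
orbit/energy form of the crux (`FramePinning`, `framePinning_implies_ladder`) and the proposed
load-bearing inequality (`CondensateBloch`).  Nothing here is proved; everything elaborates.
-/

noncomputable section

namespace Summit.HubbardSuperconductivity.HubbardSuperconductivity.Cruxes.LadderThesis.PinnedFrame

open Literature.MathematicalPhysics.QuantumLattice Literature.Probability.LatticeModels Matrix
open Summit.HubbardSuperconductivity.HubbardSuperconductivity.Theses.DeformationLadder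
open scoped ComplexOrder BigOperators

variable (L : ℕ) [NeZero L]

/-- The flat-twist angle `(2π/L) Σ_i k_i x_i` (canonical representatives in `{0,…,L-1}`). -/
def twistAngle (k x : TorusSite 2 L) : ℝ :=
  2 * Real.pi / L * ∑ i : Fin 2, ((k i).val : ℝ) * ((x i).val : ℝ)

/-- Orbital phases of the spin-↑ flat gauge transformation: `e^{-iθ_k(x)}` on `(x,↑)`, `1` on `(x,↓)`. -/
def upTwistPhase (k : TorusSite 2 L) : Orb (FermionTorus 2 L) → ℂ := fun o =>
  if (ofLex o).2 = 0 then
    Complex.exp (-(Complex.I * (twistAngle L k (FermionTorus.toTorusSite (ofLex o).1) : ℂ)))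
  else 1

/-- `D_k = exp(-i Σ_x θ_k(x) n_{x↑})`, a diagonal unitary of Fock space preserving every
`(N↑, N↓)` sector (the tree's `orbitalPhase` with spin-dependent phases). -/
def upTwist (k : TorusSite 2 L) :
    Matrix (Finset (Orb (FermionTorus 2 L))) (Finset (Orb (FermionTorus 2 L))) ℂ :=
  orbitalPhase (upTwistPhase L k)

/-- The ↑-site bond pair annihilator `Σ_e g(e) c_{x↑} c_{x+e,↓}` (no singlet symmetrisation). -/
def upPair (g : Site 2 → ℝ) (x : TorusSite 2 L) :
    Matrix (Finset (Orb (FermionTorus 2 L))) (Finset (Orb (FermionTorus 2 L))) ℂ :=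
  ∑ e ∈ insert 0 unitSteps, ((g e : ℝ) : ℂ) •
    (annihilation (orb (FermionTorus.ofTorusSite x) 0) *
      annihilation (orb (FermionTorus.ofTorusSite (x + Torus.proj L e)) 1))

/-- The pair field at pair momentum `k`, phase attached to the ↑ site:
`pF_k = √2 Σ_x e^{iθ_k(x)} Σ_e g(e) c_{x↑} c_{x+e,↓}`. -/
def pairFieldAt (g : Site 2 → ℝ) (k : TorusSite 2 L) :
    Matrix (Finset (Orb (FermionTorus 2 L))) (Finset (Orb (FermionTorus 2 L))) ℂ :=
  ((Real.sqrt 2 : ℝ) : ℂ) • ∑ x : TorusSite 2 L,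
    Complex.exp (Complex.I * (twistAngle L k x : ℂ)) • upPair L g x

/-- The momentum-`k` pair penalty `pF_kᴴ pF_k` (so that `L⁻⁴ •` it is `Π_k`). -/
def penaltyAt (g : Site 2 → ℝ) (k : TorusSite 2 L) :
    Matrix (Finset (Orb (FermionTorus 2 L))) (Finset (Orb (FermionTorus 2 L))) ℂ :=
  (pairFieldAt L g k)ᴴ * pairFieldAt L g k

/-- The first nonzero pair momentum `k₁ = (1, 0)`. -/
def kOne : TorusSite 2 L := fun i => if i = 0 then 1 else 0

/-- (a) At `k = 0` the ↑-site pair field IS the tree's singlet pair field (uses only that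
`dWaveFormFactor` is even and the CAR): `pF_0 = pairField dWaveFormFactor L = √2 Δ_d`. -/
def PairFieldAtZero : Prop :=
  ∀ (L : ℕ) [NeZero L], pairFieldAt L dWaveFormFactor 0 = pairField dWaveFormFactor L

/-- (b) **FIRST LEMMA — exact flat-gauge covariance of the zero-mode penalty.**
`D_k (pFᴴ pF) D_kᴴ = pF_kᴴ pF_k` for every `k ∈ (ℤ/L)²`: the `L²` momentum penalties are one
unitary orbit of `Π₀` under sector-preserving diagonal unitaries (from
`orbitalPhase_conj_annihilation`: `D c_{x↑} Dᴴ = e^{+iθ_k(x)} c_{x↑}`, `D c_{y↓} Dᴴ = c_{y↓}`). -/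
def Covariance : Prop :=
  ∀ (L : ℕ) [NeZero L] (k : TorusSite 2 L),
    upTwist L k * ((pairField dWaveFormFactor L)ᴴ * pairField dWaveFormFactor L) * (upTwist L k)ᴴ =
      penaltyAt L dWaveFormFactor k

/-- (c) Orbit sum rule (discrete Plancherel): `Σ_k pF_kᴴ pF_k = 2L² Σ_x (Σ_e g c_{x↑}c_{x+e↓})ᴴ(Σ_e g c_{x↑}c_{x+e↓})`
— the orbit sum of the penalty is `L²` times a LOCAL positive operator (local d-wave pair number),
so every partial orbit sum of `Π_k = L⁻⁴ pF_kᴴ pF_k` is bounded by `2L⁻² Σ_x (…)ᴴ(…) ≤ O(1)`. -/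
def OrbitSumRule : Prop :=
  ∀ (L : ℕ) [NeZero L],
    ∑ k : TorusSite 2 L, penaltyAt L dWaveFormFactor k =
      ((2 * (L : ℝ) ^ 2 : ℝ) : ℂ) • ∑ x : TorusSite 2 L, (upPair L dWaveFormFactor x)ᴴ * upPair L dWaveFormFactor x

/-- (d) `D_k` is a symmetry of the sector and `D_k H D_kᴴ` (the Hubbard torus in a FLAT spin-↑
connection of winding `k`) is isospectral with `H` on it; consequently the penalised problems
`H + s L⁻⁴ Π_k`-at-momentum-`k` and `D_kᴴ H D_k + s L⁻⁴ Π₀` have the same sector ground energy. -/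
def TwistIsospectral : Prop :=
  ∀ (L : ℕ) [NeZero L] (U s : ℝ) (N : ℕ) (k : TorusSite 2 L),
    (hubbardTorus 2 L 1 U + ((s / (L : ℝ) ^ 4 : ℝ) : ℂ) • penaltyAt L dWaveFormFactor k).minEnergyOn
        (szSector N 0) =
      ((upTwist L k)ᴴ * hubbardTorus 2 L 1 U * upTwist L k +
          ((s / (L : ℝ) ^ 4 : ℝ) : ℂ) • ((pairField dWaveFormFactor L)ᴴ * pairField dWaveFormFactor L)).minEnergyOn
        (szSector N 0)

/-- The sector ground energy of the model penalised at pair momentum `k` ("frame energy"). -/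
def frameEnergy (U δ s : ℝ) (k : TorusSite 2 L) : ℝ :=
  (hubbardTorus 2 L 1 U + ((s / (L : ℝ) ^ 4 : ℝ) : ℂ) • penaltyAt L dWaveFormFactor k).minEnergyOn
    (szSector (2 * ⌊(1 - δ) * (L : ℝ) ^ 2 / 2⌋₊) 0)

/-- (e) **Frame pinning** — the crux read across the gauge orbit: penalising the zero mode costs
`≥ a·s` MORE than penalising any other single mode (every other frame energy is itself `≥ E₀`, so
this implies the energy form `E₀(H + sΠ₀) - E₀(H) ≥ a s` of `LadderThesis`; conversely it follows
from `LadderThesis` plus the orbit sum rule, which forces `min_k (e(k) - E₀) ≤ O(s/L²)`). -/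
def FramePinning : Prop :=
  ∃ U : ℝ, 0 < U ∧ ∃ δ ∈ Set.Ioo (0:ℝ) (1 / 2), ∃ s : ℝ, 0 < s ∧ ∃ a : ℝ, 0 < a ∧ ∃ L₀ : ℕ,
    ∀ (L : ℕ) [NeZero L], L₀ ≤ L → Even L → ∀ k : TorusSite 2 L, k ≠ 0 →
      a * s ≤ frameEnergy L U δ s 0 - frameEnergy L U δ s k

/-- Frame pinning (with existence of penalised sector ground states, the route's
`PenalisedGroundStateExists`) gives `LadderThesis` by the two-line chord lemma at a smaller
penalty `s' = a s / 64` with LRO floor `a/2`. -/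
def FramePinningImpliesLadder : Prop :=
  FramePinning → PenalisedGroundStateExists → LadderThesis

/-- (f) **Condensate-improved Bloch inequality** at the first pair momentum (the proposed
load-bearing statement; equivalent, by (b) and (d), to "pair weight at momentum `k₁` costs energy
`γ` per unit up to slack `σ`"): for every normalised sector state `φ`,
`γ·L⁻⁴⟨pFᴴpF⟩_φ - σ ≤ (⟨H⟩_φ - E₀) + ⟨D_{k₁}ᴴ H D_{k₁} - H⟩_φ`, the last term being the explicit
ONE-BODY spin-↑ twist functional `(1 - cos(2π/L))⟨-T_{x↑}⟩_φ ∓ sin(2π/L)⟨J_{x↑}⟩_φ`.  Bloch's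
theorem is the case `γ = σ = 0`. -/
def CondensateBloch : Prop :=
  ∀ (U : ℝ), 0 < U → ∀ δ ∈ Set.Ioo (0:ℝ) (1 / 2), ∀ σ : ℝ, 0 < σ → ∃ γ : ℝ, 0 < γ ∧ ∃ L₀ : ℕ,
    ∀ (L : ℕ) [NeZero L], L₀ ≤ L → Even L →
      ∀ φ : Fock (Orb (FermionTorus 2 L)),
        φ ∈ szSector (2 * ⌊(1 - δ) * (L : ℝ) ^ 2 / 2⌋₊) 0 → star φ ⬝ᵥ φ = 1 →
          γ * ((expect ((pairField dWaveFormFactor L)ᴴ * pairField dWaveFormFactor L) φ).re / (L : ℝ) ^ 4) - σ ≤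
            ((expect (hubbardTorus 2 L 1 U) φ).re -
                (hubbardTorus 2 L 1 U).minEnergyOn (szSector (2 * ⌊(1 - δ) * (L : ℝ) ^ 2 / 2⌋₊) 0)) +
              (expect ((upTwist L (kOne L))ᴴ * hubbardTorus 2 L 1 U * upTwist L (kOne L) -
                  hubbardTorus 2 L 1 U) φ).re

end Summit.HubbardSuperconductivity.HubbardSuperconductivity.Cruxes.LadderThesis.PinnedFrame
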